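import Mathlib.Topology.UnitInterval
import Mathlib.Topology.Homotopy.Contractible
import Mathlib.Topology.Homotopy.Equiv
import Mathlib.Topology.CompactOpen
import Mathlib.Analysis.SpecialFunctions.Pow.Real
import HarnessLib

/-!
# The unreduced suspension of a topological space

A. Hatcher, *Algebraic Topology* (2002), Ch. 0, p. 8: the (unreduced) suspension `SP` of a space
`P` is the quotient of `P × [0, 1]` collapsing `P × {0}` to one point and `P × {1}` to another
point. Mathlib has no suspension; this file constructs it as a quotient type and records the
elementary point-set topology used by the suspension isomorphism in singular cohomology
(`Literature/AlgebraicTopology/SingularHomology/SuspensionIsomorphism.lean`):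

* `Susp P` with the quotient topology, the quotient map `Susp.mk : P × I → Susp P`
  (`isQuotientMap_mk`), the **height** `Susp.height : C(Susp P, I)` (second coordinate);
* the closed **cones** `Susp.upperThick = {1/4 ≤ height}`, `Susp.lower = {height ≤ 1/2}` whose
  interiors cover (`interior_lower_union_interior_upperThick`), and the **band**
  `upperThick ∩ lower`;
* `Susp.stretch` — the deformations `mk (p, t) ↦ mk (p, φₛ(t))` for families `φₛ : I → I` fixing
  `0` and `1`, continuous on `Susp P × I` (Whitehead's lemma: `mk × id` is a quotient map,
  Mathlib's `IsQuotientMap.continuous_lift_prod_left`), whence **the cones are contractible**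
  (`contractibleSpace_upperThick`, `contractibleSpace_lower`);
* `Susp.midHomeomorph : P × Ioo 0 1 ≃ₜ {z | 0 < height z < 1}` (the quotient map is injective and
  open off the poles), whence the **equator embedding** `Susp.toBand : P → band`,
  `p ↦ mk (p, 1/2)`, is a homotopy equivalence (`Susp.bandHomotopyEquiv`), the band deformation
  retracting onto the equator in the height coordinate.

Everything is proved; no named facts. Deliberately NOT here: the poles as named points for empty
`P` (with this definition `Susp ∅ = ∅`), Hausdorffness, the homeomorphism `S Sⁿ ≅ Sⁿ⁺¹`
(`SuspensionLikeCover.lean` treats suspension MODELS inside a given space).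

## References

* A. Hatcher, *Algebraic Topology*, CUP 2002, Ch. 0 p. 8 (suspension, cones), §2.1 Exercise 20
  (`H̃ₙ(SX) ≅ H̃ₙ₋₁(X)`). [Hatcher2002]
-/

noncomputable section

open unitInterval Set
open _root_.Topology

universe u

namespace Literature.AlgebraicTopology.Homotopy

variable (P : Type u)

/-- The equivalence relation on `P × [0, 1]` collapsing `P × {0}` and `P × {1}` to points
(Hatcher 2002, Ch. 0 p. 8). [cite: Hatcher2002, Ch. 0 p. 8] -/
def suspSetoid : Setoid (P × I) where
  r x y := x = y ∨ (x.2 = 0 ∧ y.2 = 0) ∨ (x.2 = 1 ∧ y.2 = 1)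
  iseqv := by
    refine ⟨fun x => Or.inl rfl, ?_, ?_⟩
    · rintro x y (rfl | ⟨hx, hy⟩ | ⟨hx, hy⟩)
      · exact Or.inl rfl
      · exact Or.inr (Or.inl ⟨hy, hx⟩)
      · exact Or.inr (Or.inr ⟨hy, hx⟩)
    · rintro x y z (rfl | ⟨hx, hy⟩ | ⟨hx, hy⟩) (rfl | ⟨hy', hz⟩ | ⟨hy', hz⟩)
      · exact Or.inl rfl
      · exact Or.inr (Or.inl ⟨hy', hz⟩)
      · exact Or.inr (Or.inr ⟨hy', hz⟩)
      · exact Or.inr (Or.inl ⟨hx, hy⟩)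
      · exact Or.inr (Or.inl ⟨hx, hz⟩)
      · exact absurd (hy.symm.trans hy') zero_ne_one
      · exact Or.inr (Or.inr ⟨hx, hy⟩)
      · exact absurd (hy'.symm.trans hy) zero_ne_one
      · exact Or.inr (Or.inr ⟨hx, hz⟩)

/-- **The unreduced suspension** `SP = P × [0, 1] / (P × {0}, P × {1})` (Hatcher 2002, Ch. 0,
p. 8), with the quotient topology. [cite: Hatcher2002, Ch. 0 p. 8] -/
def Susp : Type u := Quotient (suspSetoid P)

namespace Susp

variable {P}

/-- The quotient map `P × [0, 1] → SP`. [cite: Hatcher2002, Ch. 0 p. 8] -/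
def mk (x : P × I) : Susp P := Quotient.mk (suspSetoid P) x

/-- `mk` is onto. [folklore] -/
lemma mk_surjective : Function.Surjective (mk : P × I → Susp P) := Quotient.mk_surjective

/-- Two points of `P × [0, 1]` have the same image iff they are equal or both lie in `P × {0}` or
both in `P × {1}`. [cite: Hatcher2002, Ch. 0 p. 8] -/
lemma mk_eq_mk_iff {x y : P × I} :
    mk x = mk y ↔ x = y ∨ (x.2 = 0 ∧ y.2 = 0) ∨ (x.2 = 1 ∧ y.2 = 1) :=
  Quotient.eq (r := suspSetoid P)

/-- Points with the same image have the same height. [folklore] -/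
lemma snd_eq_of_mk_eq {x y : P × I} (h : mk x = mk y) : x.2 = y.2 := by
  rcases mk_eq_mk_iff.1 h with rfl | ⟨hx, hy⟩ | ⟨hx, hy⟩
  · rfl
  · rw [hx, hy]
  · rw [hx, hy]

/-- Off the two ends, `mk` is injective. [folklore] -/
lemma eq_of_mk_eq {x y : P × I} (h : mk x = mk y) (h0 : x.2 ≠ 0) (h1 : x.2 ≠ 1) : x = y := by
  rcases mk_eq_mk_iff.1 h with e | ⟨hx, -⟩ | ⟨hx, -⟩
  · exact e
  · exact absurd hx h0
  · exact absurd hx h1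

/-- Induction on points of the suspension. [folklore] -/
@[elab_as_elim]
lemma ind {motive : Susp P → Prop} (z : Susp P) (h : ∀ x, motive (mk x)) : motive z :=
  Quotient.ind h z

variable [TopologicalSpace P]

/-- The quotient topology on the suspension. [folklore] -/
instance : TopologicalSpace (Susp P) :=
  inferInstanceAs (TopologicalSpace (Quotient (suspSetoid P)))

/-- `mk` is continuous. [folklore] -/
lemma continuous_mk : Continuous (mk : P × I → Susp P) := continuous_quotient_mk'

/-- `mk` is a quotient map. [folklore] -/
lemma isQuotientMap_mk : IsQuotientMap (mk : P × I → Susp P) := isQuotientMap_quotient_mk'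

/-- **The height** `SP → [0, 1]`, the second coordinate (well defined on the quotient).
[cite: Hatcher2002, Ch. 0 p. 8] -/
def height : C(Susp P, I) where
  toFun := Quotient.lift (fun x : P × I => x.2) fun _ _ h => by
    rcases h with rfl | ⟨hx, hy⟩ | ⟨hx, hy⟩
    · rfl
    · exact hx.trans hy.symm
    · exact hx.trans hy.symm
  continuous_toFun := by
    rw [isQuotientMap_mk.continuous_iff]
    exact continuous_snd

/-- `height (mk (p, t)) = t`. [folklore] -/
@[simp] lemma height_mk (x : P × I) : height (mk x) = x.2 := rfl

/-- The suspension of a compact space is compact. [folklore] -/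
instance [CompactSpace P] : CompactSpace (Susp P) := Quotient.compactSpace

/-- The suspension of a nonempty space is nonempty. [folklore] -/
instance [Nonempty P] : Nonempty (Susp P) := ⟨mk (Classical.arbitrary P, 0)⟩

/-! ### Deformations in the height coordinate -/

/-- **Stretching the height**: for a continuous family `φ : I × I → I` (`φ (s, t)`) with
`φ (s, 0) = 0` and `φ (s, 1) = 1`, the map `(mk (p, t), s) ↦ mk (p, φ (s, t))` is well defined
and continuous on `SP × [0, 1]` (continuity from Mathlib's Whitehead lemma
`IsQuotientMap.continuous_lift_prod_left`: `mk × id` is a quotient map since `[0, 1]` is locally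
compact). [folklore] -/
def stretch (φ : C(I × I, I)) (h0 : ∀ s, φ (s, 0) = 0) (h1 : ∀ s, φ (s, 1) = 1) :
    C(Susp P × I, Susp P) where
  toFun z := Quotient.liftOn z.1 (fun x : P × I => mk (x.1, φ (z.2, x.2))) fun x y hxy => by
    rcases hxy with rfl | ⟨hx, hy⟩ | ⟨hx, hy⟩
    · rfl
    · rw [hx, hy, h0]; exact mk_eq_mk_iff.2 (Or.inr (Or.inl ⟨rfl, rfl⟩))
    · rw [hx, hy, h1]; exact mk_eq_mk_iff.2 (Or.inr (Or.inr ⟨rfl, rfl⟩))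
  continuous_toFun := by
    apply isQuotientMap_mk.continuous_lift_prod_left (Y := I)
    exact continuous_mk.comp (continuous_fst.fst.prodMk
      (φ.continuous.comp (continuous_snd.prodMk continuous_fst.snd)))

/-- `stretch φ (mk (p, t), s) = mk (p, φ (s, t))`. [folklore] -/
@[simp] lemma stretch_mk (φ : C(I × I, I)) (h0 : ∀ s, φ (s, 0) = 0) (h1 : ∀ s, φ (s, 1) = 1)
    (x : P × I) (s : I) : stretch φ h0 h1 (mk x, s) = mk (x.1, φ (s, x.2)) := rfl

/-- `height (stretch φ (z, s)) = φ (s, height z)`. [folklore] -/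
lemma height_stretch (φ : C(I × I, I)) (h0 : ∀ s, φ (s, 0) = 0) (h1 : ∀ s, φ (s, 1) = 1)
    (z : Susp P) (s : I) : height (stretch φ h0 h1 (z, s)) = φ (s, height z) := by
  induction z using ind with
  | h x => rfl

/-- A subset of the suspension cut out by a condition on the height which is stable under a
stretching family and on which the family ends at the constant height `1` is contractible (used
for the upper cones); dually for `0`. General form: if `φ (0, ·) = id`, `φ (s, ·)` preserves the
set `S` of heights, and `φ (1, t) = c` for `t ∈ S` with `c ∈ {0, 1}`, then
`{z | height z ∈ S}` is contractible. [folklore] -/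
theorem contractibleSpace_of_stretch {S : Set I} (hS : (∃ t, t ∈ S)) (φ : C(I × I, I))
    (h0 : ∀ s, φ (s, 0) = 0) (h1 : ∀ s, φ (s, 1) = 1) (hid : ∀ t, φ (0, t) = t)
    (hstab : ∀ s, ∀ t ∈ S, φ (s, t) ∈ S) (c : I) (hc : c = 0 ∨ c = 1)
    (hend : ∀ t ∈ S, φ (1, t) = c) [Nonempty P] :
    ContractibleSpace {z : Susp P | height z ∈ S} := by
  obtain ⟨t₀, ht₀⟩ := hS
  have hcS : c ∈ S := by rw [← hend t₀ ht₀]; exact hstab 1 t₀ ht₀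
  let p₀ : P := Classical.arbitrary P
  let z₀ : {z : Susp P | height z ∈ S} := ⟨mk (p₀, c), by simpa using hcS⟩
  -- the contraction
  have hmem : ∀ zs : ({z : Susp P | height z ∈ S} : Type u) × I,
      stretch φ h0 h1 (zs.1.1, zs.2) ∈ {z : Susp P | height z ∈ S} := fun zs => by
    rw [mem_setOf_eq, height_stretch]; exact hstab _ _ zs.1.2
  let H : C(({z : Susp P | height z ∈ S} : Type u) × I, {z : Susp P | height z ∈ S}) :=
    { toFun := fun zs => ⟨stretch φ h0 h1 (zs.1.1, zs.2), hmem zs⟩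
      continuous_toFun := ((stretch φ h0 h1).continuous.comp
        (continuous_subtype_val.fst'.prodMk continuous_snd)).subtype_mk hmem }
  let F : ContinuousMap.Homotopy (ContinuousMap.id _) (ContinuousMap.const _ z₀) :=
    { toFun := fun sz => H (sz.2, sz.1)
      continuous_toFun := H.continuous.comp (continuous_snd.prodMk continuous_fst)
      map_zero_left := fun z => by
        apply Subtype.ext
        change stretch φ h0 h1 (z.1, 0) = z.1
        obtain ⟨z, hz⟩ := z
        induction z using ind with
        | h x => rw [stretch_mk, hid]
      map_one_left := fun z => by
        apply Subtype.ext
        change stretch φ h0 h1 (z.1, 1) = mk (p₀, c)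
        obtain ⟨z, hz⟩ := z
        induction z using ind with
        | h x =>
          rw [stretch_mk, hend x.2 hz]
          rcases hc with rfl | rfl
          · exact mk_eq_mk_iff.2 (Or.inr (Or.inl ⟨rfl, rfl⟩))
          · exact mk_eq_mk_iff.2 (Or.inr (Or.inr ⟨rfl, rfl⟩)) }
  exact (contractible_iff_id_nullhomotopic _).2 ⟨z₀, ⟨F⟩⟩


/-! ### The cones and the band -/

/-- The height `1/4`. [folklore] -/
def quarter : I := ⟨1 / 4, by norm_num, by norm_num⟩

/-- The height `1/2` (the equator level). [folklore] -/
def mid : I := ⟨1 / 2, by norm_num, by norm_num⟩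

/-- `(quarter : ℝ) = 1/4`. [folklore] -/
@[simp] lemma coe_quarter : ((quarter : I) : ℝ) = 1 / 4 := rfl

/-- `(mid : ℝ) = 1/2`. [folklore] -/
@[simp] lemma coe_mid : ((mid : I) : ℝ) = 1 / 2 := rfl

variable (P) in
/-- The thickened upper cone `{1/4 ≤ height}` (a closed neighbourhood of the upper cone
`{1/2 ≤ height}`, deformation retracting to the north pole). [cite: Hatcher2002, Ch. 0 p. 8] -/
def upperThick : Set (Susp P) := {z | quarter ≤ height z}

variable (P) in
/-- The lower cone `{height ≤ 1/2}`. [cite: Hatcher2002, Ch. 0 p. 8] -/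
def lower : Set (Susp P) := {z | height z ≤ mid}

/-- Membership in the thickened upper cone. [folklore] -/
lemma mem_upperThick_iff {z : Susp P} : z ∈ upperThick P ↔ quarter ≤ height z := Iff.rfl

/-- Membership in the lower cone. [folklore] -/
lemma mem_lower_iff {z : Susp P} : z ∈ lower P ↔ height z ≤ mid := Iff.rfl

/-- The thickened upper cone is closed. [folklore] -/
lemma isClosed_upperThick : IsClosed (upperThick P) :=
  isClosed_le continuous_const height.continuous

/-- The lower cone is closed. [folklore] -/
lemma isClosed_lower : IsClosed (lower P) := isClosed_le height.continuous continuous_const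

/-- **The interiors of the two cones cover the suspension** (the hypothesis of excision):
`{height < 1/2} ⊆ interior lower`, `{1/4 < height} ⊆ interior upperThick`. [folklore] -/
lemma interior_lower_union_interior_upperThick :
    interior (lower P) ∪ interior (upperThick P) = univ := by
  refine eq_univ_of_forall fun z => ?_
  have hlo : IsOpen {w : Susp P | (height w : ℝ) < 1 / 2} :=
    isOpen_lt (continuous_subtype_val.comp height.continuous) continuous_const
  have hhi : IsOpen {w : Susp P | (1 / 4 : ℝ) < (height w : ℝ)} :=
    isOpen_lt continuous_const (continuous_subtype_val.comp height.continuous)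
  have h1 : {w : Susp P | (height w : ℝ) < 1 / 2} ⊆ lower P := fun w hw =>
    mem_lower_iff.2 (Subtype.coe_le_coe.1 (le_of_lt hw))
  have h2 : {w : Susp P | (1 / 4 : ℝ) < (height w : ℝ)} ⊆ upperThick P := fun w hw =>
    mem_upperThick_iff.2 (Subtype.coe_le_coe.1 (le_of_lt hw))
  by_cases h : (height z : ℝ) < 1 / 2
  · exact Or.inl (interior_mono h1 (by rw [hlo.interior_eq]; exact h))
  · refine Or.inr (interior_mono h2 ?_)
    rw [hhi.interior_eq]
    change (1 / 4 : ℝ) < (height z : ℝ)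
    rw [not_lt] at h
    linarith

/-! ### The cones are contractible -/

/-- The stretching family `φ (s, t) = min (1, (1 + 3s) t)` raising `{1/4 ≤ t}` to `1` at `s = 1`.
[folklore] -/
def raise : C(I × I, I) where
  toFun st := ⟨min 1 ((1 + 3 * (st.1 : ℝ)) * st.2), le_min zero_le_one (by
      have := st.1.2.1; have := st.2.2.1; positivity), min_le_left _ _⟩
  continuous_toFun := by
    refine Continuous.subtype_mk (continuous_const.min ?_) _
    exact ((continuous_const.add (continuous_const.mul
      (continuous_subtype_val.comp continuous_fst))).mul (continuous_subtype_val.comp continuous_snd))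

/-- The stretching family `φ (s, t) = max (0, (1 + s) t - s)` lowering `{t ≤ 1/2}` to `0` at
`s = 1`. [folklore] -/
def sink : C(I × I, I) where
  toFun st := ⟨max 0 ((1 + (st.1 : ℝ)) * st.2 - st.1), le_max_left _ _, max_le zero_le_one (by
      have h1 := st.1.2.1; have h2 := st.2.2.2; have h3 := st.1.2.2; have h4 := st.2.2.1
      nlinarith)⟩
  continuous_toFun := by
    refine Continuous.subtype_mk (continuous_const.max ?_) _
    exact ((continuous_const.add (continuous_subtype_val.comp continuous_fst)).mul
      (continuous_subtype_val.comp continuous_snd)).sub (continuous_subtype_val.comp continuous_fst)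

/-- **The thickened upper cone is contractible** (stretch the height by `raise`; Hatcher 2002,
Ch. 0 p. 8: the cones of a suspension are contractible). [cite: Hatcher2002, Ch. 0 p. 8] -/
instance contractibleSpace_upperThick [Nonempty P] : ContractibleSpace (upperThick P) := by
  refine contractibleSpace_of_stretch (S := Ici quarter) ⟨quarter, le_refl quarter⟩ raise
    (fun s => ?_) (fun s => ?_) (fun t => ?_) (fun s t ht => ?_) 1 (Or.inr rfl) (fun t ht => ?_)
  · apply Subtype.ext
    change min (1 : ℝ) ((1 + 3 * (s : ℝ)) * 0) = 0
    rw [mul_zero, min_eq_right (zero_le_one' ℝ)]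
  · apply Subtype.ext
    change min (1 : ℝ) ((1 + 3 * (s : ℝ)) * 1) = 1
    rw [mul_one, min_eq_left]; have := s.2.1; linarith
  · apply Subtype.ext
    change min (1 : ℝ) ((1 + 3 * ((0 : I) : ℝ)) * t) = t
    rw [show ((0 : I) : ℝ) = 0 from rfl, mul_zero, add_zero, one_mul, min_eq_right t.2.2]
  · change quarter ≤ raise (s, t)
    rw [← Subtype.coe_le_coe]
    change (1 / 4 : ℝ) ≤ min 1 ((1 + 3 * (s : ℝ)) * t)
    have ht' : (1 / 4 : ℝ) ≤ t := by have := Subtype.coe_le_coe.2 (show quarter ≤ t from ht); exact this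
    have hs := s.2.1
    refine le_min (by norm_num) ?_
    nlinarith
  · apply Subtype.ext
    change min (1 : ℝ) ((1 + 3 * ((1 : I) : ℝ)) * t) = 1
    have ht' : (1 / 4 : ℝ) ≤ t := by have := Subtype.coe_le_coe.2 (show quarter ≤ t from ht); exact this
    rw [show ((1 : I) : ℝ) = 1 from rfl, min_eq_left]; linarith

/-- **The lower cone is contractible** (stretch the height by `sink`). [cite: Hatcher2002, Ch. 0 p. 8] -/
instance contractibleSpace_lower [Nonempty P] : ContractibleSpace (lower P) := by
  refine contractibleSpace_of_stretch (S := Iic mid) ⟨mid, le_refl mid⟩ sink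
    (fun s => ?_) (fun s => ?_) (fun t => ?_) (fun s t ht => ?_) 0 (Or.inl rfl) (fun t ht => ?_)
  · apply Subtype.ext
    change max (0 : ℝ) ((1 + (s : ℝ)) * ((0 : I) : ℝ) - s) = 0
    rw [show ((0 : I) : ℝ) = 0 from rfl, mul_zero, zero_sub, max_eq_left]
    have := s.2.1; linarith
  · apply Subtype.ext
    change max (0 : ℝ) ((1 + (s : ℝ)) * ((1 : I) : ℝ) - s) = 1
    rw [show ((1 : I) : ℝ) = 1 from rfl, mul_one, add_sub_cancel_right, max_eq_right (zero_le_one' ℝ)]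
  · apply Subtype.ext
    change max (0 : ℝ) ((1 + ((0 : I) : ℝ)) * t - (0 : I)) = t
    rw [show ((0 : I) : ℝ) = 0 from rfl, add_zero, one_mul, sub_zero, max_eq_right t.2.1]
  · change sink (s, t) ≤ mid
    rw [← Subtype.coe_le_coe]
    change max (0 : ℝ) ((1 + (s : ℝ)) * t - s) ≤ 1 / 2
    have ht' : (t : ℝ) ≤ 1 / 2 := by have := Subtype.coe_le_coe.2 (show t ≤ mid from ht); exact this
    have hs := s.2.1; have ht0 := t.2.1
    refine max_le (by norm_num) ?_
    nlinarith
  · apply Subtype.ext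
    change max (0 : ℝ) ((1 + ((1 : I) : ℝ)) * t - (1 : I)) = 0
    have ht' : (t : ℝ) ≤ 1 / 2 := by have := Subtype.coe_le_coe.2 (show t ≤ mid from ht); exact this
    rw [show ((1 : I) : ℝ) = 1 from rfl, max_eq_left]; linarith

/-! ### Off the poles the quotient map is a homeomorphism -/

/-- The open set of heights strictly between the poles. [folklore] -/
def midHeights : Set I := {t | (0 : ℝ) < t ∧ (t : ℝ) < 1}

/-- `midHeights` is open. [folklore] -/
lemma isOpen_midHeights : IsOpen midHeights :=
  (isOpen_lt continuous_const continuous_subtype_val).inter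
    (isOpen_lt continuous_subtype_val continuous_const)

omit [TopologicalSpace P] in
/-- Heights strictly between the poles are not `0`. [folklore] -/
lemma ne_zero_of_mem_midHeights {t : I} (h : t ∈ midHeights) : t ≠ 0 := fun e => by
  have := h.1; rw [e] at this; exact lt_irrefl _ this

omit [TopologicalSpace P] in
/-- Heights strictly between the poles are not `1`. [folklore] -/
lemma ne_one_of_mem_midHeights {t : I} (h : t ∈ midHeights) : t ≠ 1 := fun e => by
  have := h.2; rw [e] at this; exact lt_irrefl _ this

variable (P) in
/-- The part of the suspension strictly between the poles. [folklore] -/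
def middle : Set (Susp P) := {z | height z ∈ midHeights}

/-- The middle part is open. [folklore] -/
lemma isOpen_middle : IsOpen (middle P) := isOpen_midHeights.preimage height.continuous

omit [TopologicalSpace P] in
/-- A subset of `P × (0, 1)` is saturated for `mk`. [folklore] -/
lemma preimage_image_mk_eq {U : Set (P × I)} (hU : ∀ x ∈ U, x.2 ∈ midHeights) :
    mk ⁻¹' (mk '' U) = U := by
  refine Subset.antisymm ?_ (subset_preimage_image _ _)
  rintro x ⟨y, hy, hxy⟩
  have h := eq_of_mk_eq hxy (ne_zero_of_mem_midHeights (hU y hy))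
    (ne_one_of_mem_midHeights (hU y hy))
  rwa [← h]

/-- `mk` maps open subsets of `P × (0, 1)` to open subsets. [folklore] -/
lemma isOpen_image_mk {U : Set (P × I)} (hUo : IsOpen U) (hU : ∀ x ∈ U, x.2 ∈ midHeights) :
    IsOpen (mk '' U) := by
  rw [← isQuotientMap_mk.isOpen_preimage, preimage_image_mk_eq hU]
  exact hUo

/-- The coordinates `P × (0, 1) → middle`, `(p, t) ↦ mk (p, t)`. [folklore] -/
def midMap (x : P × midHeights) : middle P := ⟨mk (x.1, x.2.1), x.2.2⟩

/-- `midMap` is continuous. [folklore] -/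
lemma continuous_midMap : Continuous (midMap : P × midHeights → middle P) :=
  (continuous_mk.comp (continuous_fst.prodMk (continuous_subtype_val.comp continuous_snd))).subtype_mk _

/-- `midMap` is bijective. [folklore] -/
lemma midMap_bijective : Function.Bijective (midMap : P × midHeights → middle P) := by
  constructor
  · rintro ⟨p, t⟩ ⟨p', t'⟩ h
    have h' : mk (p, t.1) = mk (p', t'.1) := congrArg Subtype.val h
    have e := eq_of_mk_eq h' (ne_zero_of_mem_midHeights t.2) (ne_one_of_mem_midHeights t.2)
    simp only [Prod.mk.injEq] at e
    exact Prod.ext e.1 (Subtype.ext e.2)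
  · rintro ⟨z, hz⟩
    induction z using ind with
    | h x => exact ⟨(x.1, ⟨x.2, hz⟩), rfl⟩

/-- `midMap` is an open map. [folklore] -/
lemma isOpenMap_midMap : IsOpenMap (midMap : P × midHeights → middle P) := by
  intro U hU
  -- transport `U` to an open subset of `P × I` inside `P × (0, 1)`
  have hemb : IsOpenEmbedding (Prod.map id Subtype.val : P × midHeights → P × I) :=
    IsOpenEmbedding.id.prodMap isOpen_midHeights.isOpenEmbedding_subtypeVal
  have hU' : IsOpen (Prod.map id Subtype.val '' U) := hemb.isOpenMap U hU
  have hmid : ∀ x ∈ Prod.map id Subtype.val '' U, x.2 ∈ midHeights := by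
    rintro _ ⟨⟨p, t⟩, -, rfl⟩; exact t.2
  have himg : (midMap '' U : Set (middle P)) =
      Subtype.val ⁻¹' (mk '' (Prod.map id Subtype.val '' U)) := by
    ext w
    constructor
    · rintro ⟨x, hx, rfl⟩
      exact ⟨Prod.map id Subtype.val x, ⟨x, hx, rfl⟩, rfl⟩
    · rintro ⟨_, ⟨x, hx, rfl⟩, h⟩
      exact ⟨x, hx, Subtype.ext h⟩
  rw [himg]
  exact (isOpen_image_mk hU' hmid).preimage continuous_subtype_val

/-- **`P × (0, 1) ≅ {0 < height < 1}`**: off the poles the quotient map is a homeomorphism onto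
the open middle part (Hatcher 2002, Ch. 0 p. 8). [cite: Hatcher2002, Ch. 0 p. 8] -/
def midHomeomorph : P × midHeights ≃ₜ middle P :=
  (Equiv.ofBijective midMap midMap_bijective).toHomeomorphOfContinuousOpen
    continuous_midMap isOpenMap_midMap

/-- `midHomeomorph` is `midMap`. [folklore] -/
@[simp] lemma midHomeomorph_apply (x : P × midHeights) : midHomeomorph x = midMap x := rfl

/-- The inverse of `midHomeomorph` on `mk (p, t)`. [folklore] -/
lemma midHomeomorph_symm_apply_mk (p : P) (t : midHeights) :
    midHomeomorph.symm ⟨mk (p, t.1), t.2⟩ = (p, t) :=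
  midHomeomorph.symm_apply_eq.2 rfl

/-! ### The band and the equator embedding -/

variable (P) in
/-- The band `{1/4 ≤ height ≤ 1/2}`, as the subset `upperThick ∩ lower` of the thickened upper
cone (the shape in which excision compares `(upperThick, band)` with `(SP, lower)`). [folklore] -/
def band : Set (upperThick P) := Subtype.val ⁻¹' lower P

/-- Membership in the band. [folklore] -/
lemma mem_band_iff {z : upperThick P} : z ∈ band P ↔ height z.1 ≤ mid := Iff.rfl

omit [TopologicalSpace P] in
/-- `1/4 ≤ 1/2` in `[0, 1]`. [folklore] -/
lemma quarter_le_mid : (quarter : I) ≤ mid := Subtype.coe_le_coe.1 (by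
  rw [coe_quarter, coe_mid]; norm_num)

omit [TopologicalSpace P] in
/-- The equator level lies strictly between the poles. [folklore] -/
lemma mid_mem_midHeights : (mid : I) ∈ midHeights := by
  change (0 : ℝ) < 1 / 2 ∧ (1 / 2 : ℝ) < 1; norm_num

/-- Points of the band lie strictly between the poles. [folklore] -/
lemma midHeights_of_band {z : upperThick P} (hz : z ∈ band P) : height z.1 ∈ midHeights := by
  have h1 : (1 / 4 : ℝ) ≤ height z.1 := by
    have := Subtype.coe_le_coe.2 (mem_upperThick_iff.1 z.2); exact this
  have h2 : (height z.1 : ℝ) ≤ 1 / 2 := by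
    have := Subtype.coe_le_coe.2 (mem_band_iff.1 hz); exact this
  exact ⟨by linarith, by linarith⟩

variable (P) in
/-- **The equator embedding** `P → band`, `p ↦ mk (p, 1/2)`. [cite: Hatcher2002, Ch. 0 p. 8] -/
def toBand : C(P, band P) where
  toFun p := ⟨⟨mk (p, mid), quarter_le_mid⟩, (le_refl mid : height (mk (p, mid)) ≤ mid)⟩
  continuous_toFun := ((continuous_mk.comp (continuous_id.prodMk continuous_const)).subtype_mk _).subtype_mk _

/-- The equator embedding in the suspension is `p ↦ mk (p, 1/2)`. [folklore] -/
@[simp] lemma coe_coe_toBand (p : P) : ((toBand P p : upperThick P) : Susp P) = mk (p, mid) := rfl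

/-- The band as a subset of the middle part. [folklore] -/
def bandToMiddle : C(band P, middle P) where
  toFun z := ⟨z.1.1, midHeights_of_band z.2⟩
  continuous_toFun := (continuous_subtype_val.comp continuous_subtype_val).subtype_mk _

variable (P) in
/-- The retraction `band → P`: the first suspension coordinate (through `midHomeomorph`). [folklore] -/
def ofBand : C(band P, P) where
  toFun z := (midHomeomorph.symm (bandToMiddle z)).1
  continuous_toFun := continuous_fst.comp (midHomeomorph.symm.continuous.comp bandToMiddle.continuous)

/-- `ofBand ∘ toBand = id`. [folklore] -/
lemma ofBand_toBand (p : P) : ofBand P (toBand P p) = p := by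
  change (midHomeomorph.symm ⟨mk (p, mid), _⟩).1 = p
  rw [show (⟨mk (p, mid), midHeights_of_band (toBand P p).2⟩ : middle P) =
    ⟨mk (p, (⟨mid, mid_mem_midHeights⟩ : midHeights).1), mid_mem_midHeights⟩ from rfl,
    midHomeomorph_symm_apply_mk]

/-- A point of the band is `mk` of its coordinates. [folklore] -/
lemma mk_ofBand (z : band P) :
    mk (ofBand P z, ((midHomeomorph.symm (bandToMiddle z)).2 : I)) = z.1.1 := by
  exact congrArg Subtype.val (midHomeomorph.apply_symm_apply (bandToMiddle z))

/-- **The equator embedding is a homotopy equivalence** `P ≃ₕ band`: `ofBand ∘ toBand = id`,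
and `toBand ∘ ofBand ≃ id` by sliding the height linearly to `1/2` inside the band.
[cite: Hatcher2002, Ch. 0 p. 8] -/
def bandHomotopyEquiv : ContinuousMap.HomotopyEquiv P (band P) where
  toFun := toBand P
  invFun := ofBand P
  left_inv := by
    refine ⟨ContinuousMap.Homotopy.refl _ |>.cast ?_ rfl⟩
    ext p; exact (ofBand_toBand p).symm
  right_inv := by
    -- the height of `z` and the linear interpolation towards `1/2`
    let τ : band P → I := fun z => ((midHomeomorph.symm (bandToMiddle z)).2 : I)
    have hτ : Continuous τ := continuous_subtype_val.comp
      (continuous_snd.comp (midHomeomorph.symm.continuous.comp bandToMiddle.continuous))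
    have hτeq : ∀ z : band P, τ z = height z.1.1 := fun z => by
      have := mk_ofBand z
      rw [← this]; rfl
    -- interpolated height, in `[1/4, 1/2]`
    have hm : ((mid : I) : ℝ) = 1 / 2 := rfl
    let θ : I × band P → I := fun sz =>
      ⟨(1 - (sz.1 : ℝ)) * (mid : ℝ) + sz.1 * (τ sz.2 : ℝ), by
        have h1 := sz.1.2.1; have h2 := sz.1.2.2; have h3 := (τ sz.2).2.1
        rw [hm]; nlinarith, by
        have h1 := sz.1.2.1; have h2 := sz.1.2.2; have h3 := (τ sz.2).2.2
        rw [hm]; nlinarith⟩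
    have hθ : Continuous θ := by
      refine Continuous.subtype_mk ?_ _
      exact ((continuous_const.sub (continuous_subtype_val.comp continuous_fst)).mul
        continuous_const).add ((continuous_subtype_val.comp continuous_fst).mul
          (continuous_subtype_val.comp (hτ.comp continuous_snd)))
    have hθlo : ∀ sz, quarter ≤ θ sz := fun sz => by
      rw [← Subtype.coe_le_coe]
      change (1 / 4 : ℝ) ≤ (1 - (sz.1 : ℝ)) * (mid : ℝ) + sz.1 * (τ sz.2 : ℝ)
      rw [hm]
      have hq : (1 / 4 : ℝ) ≤ τ sz.2 := by
        rw [hτeq]; have := Subtype.coe_le_coe.2 (mem_upperThick_iff.1 sz.2.1.2); exact this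
      have h1 := sz.1.2.1; have h2 := sz.1.2.2
      nlinarith
    have hθhi : ∀ sz, θ sz ≤ mid := fun sz => by
      rw [← Subtype.coe_le_coe]
      change (1 - (sz.1 : ℝ)) * (mid : ℝ) + sz.1 * (τ sz.2 : ℝ) ≤ 1 / 2
      rw [hm]
      have hq : (τ sz.2 : ℝ) ≤ 1 / 2 := by
        rw [hτeq]; have := Subtype.coe_le_coe.2 (mem_band_iff.1 sz.2.2); exact this
      have h1 := sz.1.2.1; have h2 := sz.1.2.2
      nlinarith
    refine ⟨{ toFun := fun sz => ⟨⟨mk (ofBand P sz.2, θ sz), hθlo sz⟩, hθhi sz⟩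
              continuous_toFun := ((continuous_mk.comp ((ofBand P).continuous.comp continuous_snd
                |>.prodMk hθ)).subtype_mk _).subtype_mk _
              map_zero_left := fun z => ?_
              map_one_left := fun z => ?_ }⟩
    · apply Subtype.ext; apply Subtype.ext
      change mk (ofBand P z, θ (0, z)) = mk (ofBand P z, mid)
      congr 2
      apply Subtype.ext
      change (1 - (0 : ℝ)) * (mid : ℝ) + 0 * (τ z : ℝ) = mid
      ring
    · apply Subtype.ext; apply Subtype.ext
      change mk (ofBand P z, θ (1, z)) = z.1.1
      rw [← mk_ofBand z]
      congr 2
      apply Subtype.ext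
      change (1 - (1 : ℝ)) * (mid : ℝ) + 1 * (τ z : ℝ) = τ z
      ring

end Susp

end Literature.AlgebraicTopology.Homotopy
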